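import Literature.AlgebraicGeometry.Motives.JacobianOfBirationalSymmetricPower
import Literature.AlgebraicGeometry.Motives.SymmetricPowerProjective
import Literature.AlgebraicGeometry.Motives.AbelianVarietyProofs
import Literature.AlgebraicGeometry.Motives.AbelianVarietyIsogenyProofs
import HarnessLib

/-!
# `dim J = g` for an abelian variety birational to the `g`-th symmetric power of a curve
# (Milne, *Jacobian Varieties*, Thm. 5.1 (a) ⇒ Prop. 2.1, the dimension half of Thm. 1.1)

Milne, *Jacobian Varieties* (Ch. VII of Cornell–Silverman), constructs the Jacobian `J` of a
complete nonsingular curve `C` of genus `g` over `k` together with `f^P : C → J` and proves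
(Thm. 5.1 (a)) that `f^{(g)} : C^{(g)} → J` is birational; in particular `dim J = dim C^{(g)} = g`
(Prop. 2.1 "The Jacobian has dimension `g`", there via the tangent space; for Weil's construction
the equality `dim J = g` is immediate from the birationality of `f^{(g)}`, Milne §7 / Weil 1948).

The tree's engine `Literature.AlgebraicGeometry.Motives.Jacobian.nonempty_of_isOpenImmersion_symPow`
(`Motives/JacobianOfBirationalSymmetricPower`) turns such data — an abelian variety `J`, a morphism
`f : C → J`, a non-empty affine open `U ⊆ C` and a non-empty open `V` of the symmetric power
`U⁽ᵐ⁺¹⁾ = Uᵐ⁺¹/𝔖` on which `f^{(m+1)}` is an open immersion — into a `Jacobian C` in the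
universal-property sense of `Motives/Jacobian`, but exports only `Nonempty (Jacobian C)`. This file
supplies the DIMENSION that comes with the same data, which is what the named fact
`Literature.AlgebraicGeometry.Motives.two_mul_dim_eq_finrank_bettiCohomology` (`2 dim J = b₁(C(ℂ))`)
needs from Weil's construction (its Hodge-theoretic half `dim J ≤ h^{1,0}(C) ≤ g(C)` being proved in
`HodgeTheory/JacobianHodgeGenus`, `HodgeTheory/CurveHodgeGenusBound`):

* `RelativeSpec.smoothOfRelativeDimension_powOver_base` — the fibre power `Xⁿ_Y → Y` of a morphism
  smooth of relative dimension `d` is smooth of relative dimension `n * d` (induction along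
  `Xⁿ⁺¹_Y ≅ Xⁿ_Y ×_Y X`; Mathlib: base change and composition of `SmoothOfRelativeDimension`);
* `topologicalKrullDim_opens_eq_of_smoothOfRelativeDimension` — a non-empty open of a scheme
  smooth of relative dimension `n` over a field has (topological Krull) dimension `n`
  (`Motives/VarietiesDimensionProofs`, Görtz–Wedhorn I Lemma 6.26);
* `RelativeSpec.ActionOver.eq_of_specializes_of_exists_aut_apply_eq`, `…_of_toQuotient_eq`,
  `…topologicalKrullDim_preimage_toQuotient_eq` — for the quotient `π : X → X/G` by a finite group
  (`RelativeSpec/FiniteGroupQuotient*`, Mumford §7 Thm. p. 66): no point specializes to another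
  point of its (finite) `π`-fibre, hence `dim π⁻¹(W) = dim W` for every open `W ⊆ X/G`
  (incomparability and going up, Stacks 0ECG, in the topological form of
  `Motives/AbelianVarietyIsogenyProofs`);
* `AbelianVariety.dim_eq_of_isOpenImmersion_symPow` — **if `f^{(n)} : U⁽ⁿ⁾ → J` is an open
  immersion on a non-empty open `V`, for `U` an affine open of a curve `C` smooth of relative
  dimension `1` over `k`, then `dim J = n`**: `dim V = dim J` through the open immersion into the
  smooth `J` (`AbelianVariety.smoothOfRelativeDimension_dim`), and `dim V = dim π⁻¹(V) = n` through
  the quotient map from the smooth `Uⁿ`;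
* `topologicalKrullDim_opens_symPowGlued`, `topologicalKrullDim_opens_symPowProj`,
  `AbelianVariety.dim_eq_of_isOpenImmersion_symPowProj`, `Jacobian.dim_eq_of_isOpenImmersion_symPowProj`
  — the same for the glued / projective symmetric power `C⁽ⁿ⁾ = symPowProj C hC n`
  (`RelativeSpec/SymmetricPowerGlued`, `Motives/SymmetricPowerProjective`), on which the chart `W` of
  `Motives/CurveSymmetricChart` lives (glued quotient map `ActionOver.gluedMk`:
  `topologicalKrullDim_preimage_gluedMk_eq`);
* `Jacobian.dim_eq_dim` — any two Jacobians of `C` have the same dimension (`Jacobian.uniqueUpToIso`);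
* `Jacobian.exists_J_eq_of_isOpenImmersion_symPow`, `Jacobian.dim_eq_of_isOpenImmersion_symPow` —
  hence, in the situation of `Jacobian.nonempty_of_isOpenImmersion_symPow` for a smooth complete
  curve, **every** Jacobian `𝒥` of `C` has `𝒥.J.dim = m + 1`.

Everything is proved; no named facts and no definitions are introduced (D-0026).

Mathlib searched (pin): `SmoothOfRelativeDimension` (`smoothOfRelativeDimension_comp`,
`smoothOfRelativeDimension_isStableUnderBaseChange`, open immersions have relative dimension `0`),
`IsHomeomorph.topologicalKrullDim_eq`, `Scheme.homeoOfIso`, `IsZariskiLocalAtTarget.restrict`,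
`morphismRestrict_base_coe`, `subtype_specializes_iff`, `Specializes.antisymm`, `Inseparable.eq`
(all used).

## References

* J. S. Milne, *Jacobian Varieties*, in G. Cornell, J. H. Silverman (eds.), *Arithmetic Geometry*,
  Springer (1986), Ch. VII: Prop. 2.1 (`dim J = g`), §3 Prop. 3.1–3.2 (`C^{(r)}`, nonsingular of
  dimension `r`), §5 Thm. 5.1 (a) (`f^{(g)}` birational), §7 (Weil's construction).
  [Milne1986JacobianVarieties]
* A. Weil, *Variétés abéliennes et courbes algébriques*, Hermann (1948).
* U. Görtz, T. Wedhorn, *Algebraic Geometry I*, 2nd ed. (2020): Lemma 6.26 (dimension of schemes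
  smooth of relative dimension `d`), Prop. 12.12 (integral morphisms preserve dimension).
  [GortzWedhorn2020]
* The Stacks project, Tag 0ECG (Lemma 29.45.9). [StacksProject]
* D. Mumford, *Abelian Varieties* (1970), §7 Thm. p. 66 (quotients by finite groups: the fibres of
  `π` are the orbits). [MumfordAV1970]
-/

noncomputable section

universe u

open CategoryTheory Limits AlgebraicGeometry Topology

/-! ### Fibre powers of smooth morphisms -/

namespace Literature.AlgebraicGeometry.RelativeSpec

section PowSmooth

variable {X Y : Scheme.{u}} (r : X ⟶ Y) (d : ℕ)

/-- **`Xⁿ_Y → Y` is smooth of relative dimension `n · d` when `X → Y` is smooth of relative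
dimension `d`** (induction along `Xⁿ⁺¹_Y ≅ Xⁿ_Y ×_Y X`: base change and composition of morphisms
smooth of a fixed relative dimension; Görtz–Wedhorn I, Prop. 6.15). In particular the `n`-th power
of a smooth curve is smooth of relative dimension `n` (Milne, *Jacobian Varieties*, §3: `Cʳ` is
nonsingular of dimension `r`). [cite: Milne1986JacobianVarieties, §3 Prop. 3.2 (proof)] -/
theorem smoothOfRelativeDimension_powOver_base [SmoothOfRelativeDimension d r] :
    ∀ n : ℕ, SmoothOfRelativeDimension (n * d) (powOver.base r n)
  | 0 => by
    rw [Nat.zero_mul]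
    infer_instance
  | n + 1 => by
    haveI := smoothOfRelativeDimension_powOver_base n
    haveI := smoothOfRelativeDimension_isStableUnderBaseChange (n := d)
    haveI : SmoothOfRelativeDimension d (pullback.fst (powOver.base r n) r) :=
      MorphismProperty.pullback_fst _ _ ‹SmoothOfRelativeDimension d r›
    have h : SmoothOfRelativeDimension (0 + (d + n * d))
        ((powSuccIso r n).hom ≫ pullback.fst (powOver.base r n) r ≫ powOver.base r n) :=
      inferInstance
    rw [powSuccIso_hom_fst_base] at h
    have e : 0 + (d + n * d) = (n + 1) * d := by ring
    rwa [e] at h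

end PowSmooth

end Literature.AlgebraicGeometry.RelativeSpec

/-! ### Dimension of opens of schemes smooth over a field -/

namespace Literature.AlgebraicGeometry.Motives

section OpensDim

variable {K : Type u} [Field K] {X : Scheme.{u}} (f : X ⟶ Spec (CommRingCat.of K)) (n : ℕ)

/-- **A scheme admitting an open immersion with non-empty source into a scheme smooth of relative
dimension `n` over a field has dimension `n`**: the composite `W' ↪ X → Spec K` is smooth of
relative dimension `0 + n`, and `Motives/VarietiesDimensionProofs` applies (Görtz–Wedhorn I,
Lemma 6.26 with Lemma 5.7 (4)). [cite: GortzWedhorn2020, Lemma 6.26 and Lemma 5.7 (4)] -/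
theorem topologicalKrullDim_eq_of_isOpenImmersion_of_smoothOfRelativeDimension
    [SmoothOfRelativeDimension n f] {W' : Scheme.{u}} (g : W' ⟶ X) [IsOpenImmersion g]
    [Nonempty W'] : topologicalKrullDim W' = n := by
  haveI : SmoothOfRelativeDimension (0 + n) (g ≫ f) := inferInstance
  have h := topologicalKrullDim_eq_of_smoothOfRelativeDimension (g ≫ f) (0 + n)
  rwa [Nat.zero_add] at h

/-- **A non-empty open of a scheme smooth of relative dimension `n` over a field has dimension
`n`** (Görtz–Wedhorn I, Lemma 6.26 with Lemma 5.7 (4)). [cite: GortzWedhorn2020, Lemma 6.26 and Lemma 5.7 (4)] -/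
theorem topologicalKrullDim_opens_eq_of_smoothOfRelativeDimension [SmoothOfRelativeDimension n f]
    (W : X.Opens) (hW : (W : Set X).Nonempty) :
    topologicalKrullDim W = n := by
  haveI : Nonempty (W : Scheme.{u}) := by
    obtain ⟨x, hx⟩ := hW
    exact ⟨(⟨x, hx⟩ : W)⟩
  exact topologicalKrullDim_eq_of_isOpenImmersion_of_smoothOfRelativeDimension f n W.ι

end OpensDim

end Literature.AlgebraicGeometry.Motives

/-! ### Quotients by finite groups preserve the dimension of opens -/

namespace Literature.AlgebraicGeometry.RelativeSpec

namespace ActionOver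

variable {X Y : Scheme.{u}} {r : X ⟶ Y} {G : Type*} [Group G] (ρ : ActionOver r G)
variable [Finite G] [IsAffineHom r]

omit [Finite G] [IsAffineHom r] in
/-- **No point specializes to a different point of its orbit under a finite group**: if `a ⤳ g a`
for `g` of finite order `N` acting by a homeomorphism, then `g a ⤳ g² a ⤳ ⋯ ⤳ g^N a = a`, whence
`g a ⤳ a` and `a = g a` (`X` is `T₀`). This is the topological content of incomparability for the
quotient maps `X → X/G` (affine `toQuotient` or glued `gluedMk`), whose fibres are the orbits
(Mumford, *Abelian Varieties*, §7 Thm. p. 66 (1)). [cite: MumfordAV1970, §7 Thm. p. 66 (1)] [cite: StacksProject, Tag 0ECG (Lemma 29.45.9)] -/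
theorem eq_of_specializes_of_exists_aut_apply_eq [Finite G] {a b : X} (hab : a ⤳ b)
    (h : ∃ g : G, (ρ.aut g).hom a = b) : a = b := by
  obtain ⟨g, rfl⟩ := h
  set φ : X → X := fun x ↦ (ρ.aut g).hom x with hφ
  have hcont : Continuous φ := (ρ.aut g).hom.continuous
  have hiter : ∀ (i : ℕ) (x : X), φ^[i] x = (ρ.aut (g ^ i)).hom x := by
    intro i
    induction i with
    | zero =>
      intro x
      rw [Function.iterate_zero_apply, pow_zero, map_one]
      rfl
    | succ i ih =>
      intro x
      rw [Function.iterate_succ_apply, ih, pow_succ, map_mul]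
      change _ = ((ρ.aut g).hom ≫ (ρ.aut (g ^ i)).hom) x
      rw [Scheme.Hom.comp_apply]
  have hstep : ∀ i : ℕ, φ^[i] a ⤳ φ^[i + 1] a := fun i ↦ by
    rw [Function.iterate_succ_apply]
    exact hab.map (hcont.iterate i)
  have hchain : ∀ i : ℕ, φ a ⤳ φ^[i + 1] a := by
    intro i
    induction i with
    | zero => exact specializes_rfl
    | succ i ih => exact ih.trans (hstep (i + 1))
  obtain ⟨N, hN⟩ : ∃ N, orderOf g = N + 1 := Nat.exists_eq_succ_of_ne_zero (orderOf_pos g).ne'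
  have hNa : φ^[N + 1] a = a := by
    rw [hiter, ← hN, pow_orderOf_eq_one, map_one]
    rfl
  have hba : φ a ⤳ a := by
    have := hchain N
    rwa [hNa] at this
  exact (hab.antisymm hba).eq

/-- **Incomparability for `π : X → X/G`**: no point of `X` specializes to a different point of its
own `π`-fibre, the fibres of `π` being the `G`-orbits (Mumford, *Abelian Varieties*, §7 Thm. p. 66
(1), `toQuotient_eq_iff`; `eq_of_specializes_of_exists_aut_apply_eq`).
[cite: MumfordAV1970, §7 Thm. p. 66 (1)] [cite: StacksProject, Tag 0ECG (Lemma 29.45.9)] -/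
theorem eq_of_specializes_of_toQuotient_eq {a b : X} (hab : a ⤳ b)
    (h : ρ.toQuotient a = ρ.toQuotient b) : a = b :=
  ρ.eq_of_specializes_of_exists_aut_apply_eq hab (ρ.toQuotient_eq_iff.mp h)

/-- **The quotient map does not lower the dimension of opens**: `dim π⁻¹(W) ≤ dim W` for every
open `W ⊆ X/G` (incomparability: `π` is strictly monotone for the specialization orders, by
`eq_of_specializes_of_toQuotient_eq`; the topological form of Stacks 00GT / 0ECG).
[cite: StacksProject, Tag 0ECG (Lemma 29.45.9)] [cite: MumfordAV1970, §7 Thm. p. 66 (1)] -/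
theorem topologicalKrullDim_preimage_toQuotient_le (W : ρ.quotient.Opens) :
    topologicalKrullDim (ρ.toQuotient ⁻¹ᵁ W) ≤ topologicalKrullDim W := by
  refine Literature.AlgebraicGeometry.Motives.topologicalKrullDim_le_of_specializes_imp_eq
    (f := fun x ↦ (ρ.toQuotient ∣_ W) x) (ρ.toQuotient ∣_ W).continuous fun a b hab hfab ↦ ?_
  have hab' : a.1 ⤳ b.1 := (subtype_specializes_iff a b).mp hab
  have hfab' : ρ.toQuotient a.1 = ρ.toQuotient b.1 := by
    have := congrArg Subtype.val hfab
    rwa [morphismRestrict_base_coe, morphismRestrict_base_coe] at this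
  exact Subtype.ext (ρ.eq_of_specializes_of_toQuotient_eq hab' hfab')

/-- **`dim π⁻¹(W) = dim W` for every open `W ⊆ X/G`**: `≤` by incomparability
(`topologicalKrullDim_preimage_toQuotient_le`), `≥` by going up for the closed surjection
`π⁻¹(W) → W` (restriction of the integral, surjective `π`; Stacks 0ECG = Lemma 29.45.9,
Görtz–Wedhorn I Prop. 12.12). [cite: StacksProject, Tag 0ECG (Lemma 29.45.9)] [cite: GortzWedhorn2020, Prop. 12.12] -/
theorem topologicalKrullDim_preimage_toQuotient_eq (W : ρ.quotient.Opens) :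
    topologicalKrullDim (ρ.toQuotient ⁻¹ᵁ W) = topologicalKrullDim W := by
  refine le_antisymm (ρ.topologicalKrullDim_preimage_toQuotient_le W) ?_
  haveI : UniversallyClosed ρ.toQuotient := ρ.universallyClosed_toQuotient
  haveI : Surjective ρ.toQuotient := ρ.surjective_toQuotient'
  haveI : UniversallyClosed (ρ.toQuotient ∣_ W) := IsZariskiLocalAtTarget.restrict ‹_› W
  haveI : Surjective (ρ.toQuotient ∣_ W) := IsZariskiLocalAtTarget.restrict ‹_› W
  exact Literature.AlgebraicGeometry.Motives.Scheme.topologicalKrullDim_le_of_universallyClosed_of_surjective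
    (ρ.toQuotient ∣_ W)

/-- The preimage of a non-empty open of `X/G` under the (surjective) quotient map is non-empty.
[cite: MumfordAV1970, §7 Thm. p. 66 (1)] -/
theorem preimage_toQuotient_nonempty {W : ρ.quotient.Opens} (hW : (W : Set ρ.quotient).Nonempty) :
    ((ρ.toQuotient ⁻¹ᵁ W : X.Opens) : Set X).Nonempty := by
  obtain ⟨w, hw⟩ := hW
  obtain ⟨x, hx⟩ := ρ.surjective_toQuotient'.1 w
  exact ⟨x, show ρ.toQuotient x ∈ W by rw [hx]; exact hw⟩

/-! #### The glued quotient `X → X/G` (`ActionOver.gluedMk`) -/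

section Glued

omit [IsAffineHom r]

variable [Y.IsSeparated] [IsSeparated r] (hcov : ∀ x : X, ∃ O : ρ.StableAffineOpens, x ∈ O.1)

/-- **`dim π⁻¹(W) ≤ dim W` for the glued quotient map** `π : X → X/G` (`ActionOver.gluedMk`, for
actions all of whose orbits lie in `G`-stable opens affine over `Y`) and every open `W ⊆ X/G`:
incomparability, the fibres of `π` being the orbits (`exists_aut_apply_eq_of_gluedMk_eq`).
[cite: StacksProject, Tag 0ECG (Lemma 29.45.9)] [cite: MumfordAV1970, §7 Thm. p. 66 (1)] -/
theorem topologicalKrullDim_preimage_gluedMk_le (W : ρ.glued.Opens) :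
    topologicalKrullDim (ρ.gluedMk hcov ⁻¹ᵁ W) ≤ topologicalKrullDim W := by
  refine Literature.AlgebraicGeometry.Motives.topologicalKrullDim_le_of_specializes_imp_eq
    (f := fun x ↦ (ρ.gluedMk hcov ∣_ W) x) (ρ.gluedMk hcov ∣_ W).continuous fun a b hab hfab ↦ ?_
  have hab' : a.1 ⤳ b.1 := (subtype_specializes_iff a b).mp hab
  have hfab' : ρ.gluedMk hcov a.1 = ρ.gluedMk hcov b.1 := by
    have := congrArg Subtype.val hfab
    rwa [morphismRestrict_base_coe, morphismRestrict_base_coe] at this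
  exact Subtype.ext (ρ.eq_of_specializes_of_exists_aut_apply_eq hab'
    (ρ.exists_aut_apply_eq_of_gluedMk_eq hcov hfab'))

/-- **`dim π⁻¹(W) = dim W` for the glued quotient map and every open `W ⊆ X/G`** (`≤` by
incomparability, `≥` by going up: `π` is integral, hence universally closed, and surjective).
[cite: StacksProject, Tag 0ECG (Lemma 29.45.9)] [cite: GortzWedhorn2020, Prop. 12.12] -/
theorem topologicalKrullDim_preimage_gluedMk_eq (W : ρ.glued.Opens) :
    topologicalKrullDim (ρ.gluedMk hcov ⁻¹ᵁ W) = topologicalKrullDim W := by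
  refine le_antisymm (ρ.topologicalKrullDim_preimage_gluedMk_le hcov W) ?_
  have hu : UniversallyClosed (ρ.gluedMk hcov) := inferInstance
  have hs : Surjective (ρ.gluedMk hcov) := inferInstance
  haveI : UniversallyClosed (ρ.gluedMk hcov ∣_ W) := IsZariskiLocalAtTarget.restrict hu W
  haveI : Surjective (ρ.gluedMk hcov ∣_ W) := IsZariskiLocalAtTarget.restrict hs W
  exact Literature.AlgebraicGeometry.Motives.Scheme.topologicalKrullDim_le_of_universallyClosed_of_surjective
    (ρ.gluedMk hcov ∣_ W)

/-- The preimage of a non-empty open of `X/G` under the (surjective) glued quotient map is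
non-empty. [cite: MumfordAV1970, §7 Thm. p. 66 (1)] -/
theorem preimage_gluedMk_nonempty {W : ρ.glued.Opens} (hW : (W : Set ρ.glued).Nonempty) :
    ((ρ.gluedMk hcov ⁻¹ᵁ W : X.Opens) : Set X).Nonempty := by
  obtain ⟨w, hw⟩ := hW
  obtain ⟨x, hx⟩ := ρ.gluedMk_surjective hcov w
  exact ⟨x, show ρ.gluedMk hcov x ∈ W by rw [hx]; exact hw⟩

end Glued

end ActionOver

/-! ### Dimension of opens of the symmetric power of a smooth scheme over a field -/

section SymPowDim

variable {K : Type u} [Field K] {X : Scheme.{u}} (r : X ⟶ Spec (CommRingCat.of K)) [IsAffineHom r]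
  (d : ℕ) [SmoothOfRelativeDimension d r] (n : ℕ)

/-- **Every non-empty open of `Symⁿ_K(X)` has dimension `n · d`** for `X → Spec K` affine and
smooth of relative dimension `d` (e.g. an affine open of a smooth curve, `d = 1`: Milne,
*Jacobian Varieties*, Prop. 3.2, "`C^{(r)}` … has dimension `r`"): its preimage in the smooth `Xⁿ_K`
has dimension `n · d`, and the quotient map by `𝔖ₙ` preserves the dimension of opens.
[cite: Milne1986JacobianVarieties, §3 Prop. 3.2] [cite: StacksProject, Tag 0ECG (Lemma 29.45.9)] -/
theorem topologicalKrullDim_opens_symPow (W : (symPow r n).Opens)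
    (hW : (W : Set (symPow r n)).Nonempty) : topologicalKrullDim W = (n * d : ℕ) := by
  rw [← (permAction r n).topologicalKrullDim_preimage_toQuotient_eq W]
  haveI := smoothOfRelativeDimension_powOver_base r d n
  exact Literature.AlgebraicGeometry.Motives.topologicalKrullDim_opens_eq_of_smoothOfRelativeDimension
    (powOver.base r n) (n * d) _ ((permAction r n).preimage_toQuotient_nonempty hW)

end SymPowDim

section SymPowGluedDim

variable {K : Type u} [Field K] {X : Scheme.{u}} (r : X ⟶ Spec (CommRingCat.of K)) [IsSeparated r]
  (hX : FiniteSubsetsInAffineOpens r) (d : ℕ) [SmoothOfRelativeDimension d r] (n : ℕ)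

include hX in
/-- **Every non-empty open of the glued symmetric power `X⁽ⁿ⁾_K = symPowGlued r n` has dimension
`n · d`** for `X → Spec K` separated, smooth of relative dimension `d`, with finite subsets in
affine opens (e.g. a smooth projective curve, `d = 1`: Milne, *Jacobian Varieties*, Prop. 3.2,
"`C^{(r)}` … has dimension `r`"): preimage in the smooth `Xⁿ_K`, and the glued quotient map
preserves the dimension of opens. [cite: Milne1986JacobianVarieties, §3 Prop. 3.2] [cite: StacksProject, Tag 0ECG (Lemma 29.45.9)] -/
theorem topologicalKrullDim_opens_symPowGlued (W : (symPowGlued r n).Opens)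
    (hW : (W : Set (symPowGlued r n)).Nonempty) : topologicalKrullDim W = (n * d : ℕ) := by
  have hcov : ∀ z : powOver r n, ∃ O : (permAction r n).StableAffineOpens, z ∈ O.1 :=
    exists_stableAffineOpen_mem hX
  have h1 : topologicalKrullDim (symPowGlued.mk r n hX ⁻¹ᵁ W) = topologicalKrullDim W :=
    (permAction r n).topologicalKrullDim_preimage_gluedMk_eq hcov W
  rw [← h1]
  haveI := smoothOfRelativeDimension_powOver_base r d n
  exact Literature.AlgebraicGeometry.Motives.topologicalKrullDim_opens_eq_of_smoothOfRelativeDimension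
    (powOver.base r n) (n * d) _ ((permAction r n).preimage_gluedMk_nonempty hcov hW)

end SymPowGluedDim

end Literature.AlgebraicGeometry.RelativeSpec

/-! ### `dim J = g` from an open immersion `f^{(g)}|_V : V ↪ J`, `∅ ≠ V ⊆ U⁽ᵍ⁾` -/

namespace Literature.AlgebraicGeometry.Motives

open Literature.AlgebraicGeometry.RelativeSpec
open scoped MonObj

variable {k : Type u} [Field k] {C : SchemeOver k}

/-- **`dim J = n` when `f^{(n)} : U⁽ⁿ⁾ → J` is an open immersion on a non-empty open** (the
dimension content of Milne, *Jacobian Varieties*, Thm. 5.1 (a) "`f^{(g)} : C^{(g)} → J` is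
birational" combined with Prop. 3.2 "`C^{(r)}` is nonsingular of dimension `r`", i.e. Prop. 2.1
`dim J = g` for a Jacobian obtained by Weil's construction, §7): here `C → Spec k` is smooth of
relative dimension `1`, `U ⊆ C` an affine open, `J` an abelian variety, `f : C → J`, and `V` a
non-empty open of the symmetric power `U⁽ⁿ⁾ = Uⁿ/𝔖ₙ` with `f^{(n)}|_V` an open immersion. Proof:
`dim V = dim J` (open immersion into `J`, smooth of relative dimension `dim J`,
`AbelianVariety.smoothOfRelativeDimension_dim`) and `dim V = n` (`topologicalKrullDim_opens_symPow`).
[cite: Milne1986JacobianVarieties, §5 Thm. 5.1 (a), §3 Prop. 3.2 and §2 Prop. 2.1] -/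
theorem AbelianVariety.dim_eq_of_isOpenImmersion_symPow [SmoothOfRelativeDimension 1 C.hom]
    (U : C.left.Opens) [IsAffine U] (J : AbelianVariety k) (f : C ⟶ J.X) (n : ℕ)
    (V : (symPow (U.ι ≫ C.hom) n).Opens) (hV : (V : Set (symPow (U.ι ≫ C.hom) n)).Nonempty)
    [IsOpenImmersion (V.ι ≫ (sumDescOver U J f n).left)] : J.dim = n := by
  -- `dim V = dim J`
  haveI : Nonempty (V : Scheme.{u}) := by
    obtain ⟨v, hv⟩ := hV
    exact ⟨(⟨v, hv⟩ : V)⟩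
  haveI := J.smoothOfRelativeDimension_dim
  have h1 : topologicalKrullDim V = J.dim :=
    topologicalKrullDim_eq_of_isOpenImmersion_of_smoothOfRelativeDimension J.X.hom J.dim
      (V.ι ≫ (sumDescOver U J f n).left)
  -- `dim V = n`, the curve piece `U → Spec k` being smooth of relative dimension `1`
  haveI : SmoothOfRelativeDimension 1 (U.ι ≫ C.hom) := by
    have : SmoothOfRelativeDimension (0 + 1) (U.ι ≫ C.hom) := inferInstance
    rwa [Nat.zero_add] at this
  have h2 : topologicalKrullDim V = (n * 1 : ℕ) := topologicalKrullDim_opens_symPow (U.ι ≫ C.hom) 1 n V hV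
  rw [Nat.mul_one] at h2
  rw [h1] at h2
  exact_mod_cast h2

/-- **Every non-empty open of the projective symmetric power `C⁽ⁿ⁾ = symPowProj C hC n` has
dimension `n · d`** for `C` projective and smooth of relative dimension `d` over `k` (Milne,
*Jacobian Varieties*, Prop. 3.2 for curves). [cite: Milne1986JacobianVarieties, §3 Prop. 3.2] -/
theorem topologicalKrullDim_opens_symPowProj (hC : IsProjectiveOver C) (d : ℕ)
    [SmoothOfRelativeDimension d C.hom] (n : ℕ) (W : (symPowProj C hC n).left.Opens)
    (hW : (W : Set (symPowProj C hC n).left).Nonempty) : topologicalKrullDim W = (n * d : ℕ) :=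
  haveI := hC.isSeparated
  topologicalKrullDim_opens_symPowGlued C.hom hC.finiteSubsetsInAffineOpens d n W hW

/-- **`dim J = n` when a non-empty open of the projective symmetric power `C⁽ⁿ⁾` of a smooth
projective curve embeds openly into `J`** (the form of Milne Thm. 5.1 (a) "`f^{(g)} : C^{(g)} → J`
is birational" on the glued `C^{(g)} = symPowProj`, e.g. on the chart `W ⊆ C^{(g)}` of
`Motives/CurveSymmetricChart`): `dim V = dim J` through the open immersion and `dim V = n`
(`topologicalKrullDim_opens_symPowProj`). [cite: Milne1986JacobianVarieties, §5 Thm. 5.1 (a), §3 Prop. 3.2 and §2 Prop. 2.1] -/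
theorem AbelianVariety.dim_eq_of_isOpenImmersion_symPowProj [SmoothOfRelativeDimension 1 C.hom]
    (hC : IsProjectiveOver C) (J : AbelianVariety k) (n : ℕ) (V : (symPowProj C hC n).left.Opens)
    (hV : (V : Set (symPowProj C hC n).left).Nonempty) (e : (V : Scheme.{u}) ⟶ J.X.left)
    [IsOpenImmersion e] : J.dim = n := by
  haveI : Nonempty (V : Scheme.{u}) := by
    obtain ⟨v, hv⟩ := hV
    exact ⟨(⟨v, hv⟩ : V)⟩
  haveI := J.smoothOfRelativeDimension_dim
  have h1 : topologicalKrullDim V = J.dim :=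
    topologicalKrullDim_eq_of_isOpenImmersion_of_smoothOfRelativeDimension J.X.hom J.dim e
  have h2 : topologicalKrullDim V = (n * 1 : ℕ) := topologicalKrullDim_opens_symPowProj hC 1 n V hV
  rw [Nat.mul_one] at h2
  rw [h1] at h2
  exact_mod_cast h2

namespace Jacobian

/-- **All Jacobians of `C` have the same dimension**: two Jacobians are isomorphic
(`Jacobian.uniqueUpToIso`, Milne Remark 6.5), and isomorphic abelian varieties have homeomorphic
underlying spaces. [cite: Milne1986JacobianVarieties, §6 Remark 6.5] -/
theorem dim_eq_dim (𝒥₁ 𝒥₂ : Jacobian C) : 𝒥₁.J.dim = 𝒥₂.J.dim := by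
  let e := uniqueUpToIso 𝒥₁ 𝒥₂
  haveI : IsIso (AbelianVariety.Hom.toSchemeHom e.hom) :=
    ⟨AbelianVariety.Hom.toSchemeHom e.inv,
      by
        change AbelianVariety.Hom.toSchemeHom (e.hom ≫ e.inv) = _
        rw [e.hom_inv_id]; rfl,
      by
        change AbelianVariety.Hom.toSchemeHom (e.inv ≫ e.hom) = _
        rw [e.inv_hom_id]; rfl⟩
  have h := IsHomeomorph.topologicalKrullDim_eq _
    (Scheme.homeoOfIso (asIso (AbelianVariety.Hom.toSchemeHom e.hom))).isHomeomorph
  unfold AbelianVariety.dim schemeDim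
  rw [h]

/-- In the situation of `Jacobian.nonempty_of_isOpenImmersion_symPow` — `C` complete and
geometrically integral with a rational point `P`, `f : C → J` with `f(P) = 0` and `f^{(m+1)}` an
open immersion on a non-empty open `V ⊆ U⁽ᵐ⁺¹⁾` — **there is a Jacobian of `C` whose abelian
variety is the given `J`** (the one constructed there, `Jacobian.ofPointed`; recorded with its
`J`-component, which `Nonempty (Jacobian C)` forgets). [cite: Milne1986JacobianVarieties, §6 Prop. 6.1 and Prop. 6.4 (proofs), §5 Thm. 5.1 (a)] -/
theorem exists_J_eq_of_isOpenImmersion_symPow [IsProper C.hom] [GeometricallyIntegral C.hom]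
    (P : AlgPoints C k) (J : AbelianVariety k) (f : C ⟶ J.X) (hf : P ≫ f = 1) (m : ℕ)
    (U : C.left.Opens) [IsAffine U] (PU : specOver k k ⟶ pieceOver U) (hPU : PU ≫ pieceι U = P)
    (V : (symPow (U.ι ≫ C.hom) (m + 1)).Opens) (hV : (V : Set (symPow (U.ι ≫ C.hom) (m + 1))).Nonempty)
    [IsOpenImmersion (V.ι ≫ (sumDescOver U J f (m + 1)).left)] :
    ∃ 𝒥 : Jacobian C, 𝒥.J = J := by
  classical
  haveI : Nonempty U := ⟨show (U : Scheme.{u}) from PU.left (default : ↥(Spec (.of k)))⟩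
  haveI : LocallyOfFiniteType C.hom := inferInstance
  refine ⟨Jacobian.ofPointed P J f hf
    (fun φ hφ => (exists_hom_comp_eq_of_isOpenImmersion J f m V hV P PU hPU hf φ hφ).choose)
    (fun φ hφ => (exists_hom_comp_eq_of_isOpenImmersion J f m V hV P PU hPU hf φ hφ).choose_spec)
    (fun φ hφ ψ hψ => hom_ext_of_isOpenImmersion J f (m + 1) V hV _ _ ?_), rfl⟩
  rw [hψ, (exists_hom_comp_eq_of_isOpenImmersion J f m V hV P PU hPU hf φ hφ).choose_spec]

/-- **`dim 𝒥 = g` for every Jacobian of a curve admitting Weil's data** (Milne, *Jacobian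
Varieties*, Prop. 2.1 via Thm. 5.1 (a) and Remark 6.5): if `C → Spec k` is complete, geometrically
integral and smooth of relative dimension `1`, `P ∈ C(k)`, `f : C → J` with `f(P) = 0`, and
`f^{(m+1)} : U⁽ᵐ⁺¹⁾ → J` is an open immersion on a non-empty open `V` (`U ∋ P` affine open), then
every Jacobian `𝒥` of `C` in the sense of `Motives/Jacobian` has `dim 𝒥.J = m + 1`
(`AbelianVariety.dim_eq_of_isOpenImmersion_symPow` for the given `J`, which is the abelian variety of
a Jacobian of `C`, and `dim_eq_dim`). [cite: Milne1986JacobianVarieties, §2 Prop. 2.1, §5 Thm. 5.1 (a) and §6 Remark 6.5] -/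
theorem dim_eq_of_isOpenImmersion_symPow [IsProper C.hom] [GeometricallyIntegral C.hom]
    [SmoothOfRelativeDimension 1 C.hom] (𝒥 : Jacobian C)
    (P : AlgPoints C k) (J : AbelianVariety k) (f : C ⟶ J.X) (hf : P ≫ f = 1) (m : ℕ)
    (U : C.left.Opens) [IsAffine U] (PU : specOver k k ⟶ pieceOver U) (hPU : PU ≫ pieceι U = P)
    (V : (symPow (U.ι ≫ C.hom) (m + 1)).Opens) (hV : (V : Set (symPow (U.ι ≫ C.hom) (m + 1))).Nonempty)
    [IsOpenImmersion (V.ι ≫ (sumDescOver U J f (m + 1)).left)] :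
    𝒥.J.dim = m + 1 := by
  obtain ⟨𝒥₀, h𝒥₀⟩ := exists_J_eq_of_isOpenImmersion_symPow P J f hf m U PU hPU V hV
  rw [dim_eq_dim 𝒥 𝒥₀, h𝒥₀]
  exact AbelianVariety.dim_eq_of_isOpenImmersion_symPow U J f (m + 1) V hV

/-- Same, for a smooth projective curve (`IsSmoothProjective 1 C`: completeness, geometric
integrality and smoothness are the discharged facts `IsSmoothProjective.isProper_holds`,
`.geometricallyIntegral_holds`, `.smoothOfRelativeDimension`). [cite: Milne1986JacobianVarieties, §2 Prop. 2.1, §5 Thm. 5.1 (a) and §6 Remark 6.5] -/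
theorem dim_eq_of_isSmoothProjective_of_isOpenImmersion_symPow (hC : IsSmoothProjective 1 C)
    (𝒥 : Jacobian C)
    (P : AlgPoints C k) (J : AbelianVariety k) (f : C ⟶ J.X) (hf : P ≫ f = 1) (m : ℕ)
    (U : C.left.Opens) [IsAffine U] (PU : specOver k k ⟶ pieceOver U) (hPU : PU ≫ pieceι U = P)
    (V : (symPow (U.ι ≫ C.hom) (m + 1)).Opens) (hV : (V : Set (symPow (U.ι ≫ C.hom) (m + 1))).Nonempty)
    [IsOpenImmersion (V.ι ≫ (sumDescOver U J f (m + 1)).left)] :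
    𝒥.J.dim = m + 1 :=
  haveI := IsSmoothProjective.isProper_holds hC
  haveI := IsSmoothProjective.geometricallyIntegral_holds hC
  haveI := hC.smoothOfRelativeDimension
  dim_eq_of_isOpenImmersion_symPow 𝒥 P J f hf m U PU hPU V hV

/-- **`dim 𝒥 = n` for every Jacobian of `C` once the abelian variety of ONE Jacobian receives an
open immersion from a non-empty open of `C⁽ⁿ⁾ = symPowProj C hC n`** (Milne Thm. 5.1 (a) on the
glued symmetric power, Remark 6.5). [cite: Milne1986JacobianVarieties, §2 Prop. 2.1, §5 Thm. 5.1 (a) and §6 Remark 6.5] -/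
theorem dim_eq_of_isOpenImmersion_symPowProj [SmoothOfRelativeDimension 1 C.hom]
    (hC : IsProjectiveOver C) (𝒥 𝒥₀ : Jacobian C) (n : ℕ) (V : (symPowProj C hC n).left.Opens)
    (hV : (V : Set (symPowProj C hC n).left).Nonempty) (e : (V : Scheme.{u}) ⟶ 𝒥₀.J.X.left)
    [IsOpenImmersion e] : 𝒥.J.dim = n := by
  rw [dim_eq_dim 𝒥 𝒥₀]
  exact AbelianVariety.dim_eq_of_isOpenImmersion_symPowProj hC 𝒥₀.J n V hV e

end Jacobian

end Literature.AlgebraicGeometry.Motives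

end
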